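import Literature.NumberTheory.Sieve.DispersionMoebiusMainTermPrelims
import Literature.NumberTheory.Sieve.CoprimeMoebiusLogHarmonicIntervals
import HarnessLib

/-!
# The main term of a Linnik dispersion with Möbius coefficients

Topic `Literature/NumberTheory/Sieve`.  Everything in this file is PROVED (theorems only).

In a dispersion `𝒟 = Σ_d F(d) |Σ_u α_u Σ_m 1[u ∣ A d m + B]|²` over squarefree moduli `u ∼ U` coprime to
`A B`, Poisson summation in `d` produces the main term (frequency `0`)

  `MT = (∫F)/Q · Σ_{u,u'} α_u α_{u'} N(u,u')/lcm(u,u')`,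
  `N(u,u') = #{(y,y') : (m,u) = (m',u') = 1, m ≡ m' (mod (u,u'))}`,  `m = c + Qy`, `m' = c + Qy'`

(the density of the `d` with `u ∣ Adm + B`, `u' ∣ Adm' + B`).  When `α_u = μ(tu) log(tu)/L` carries the Möbius
function, the prime number theorem for `μ` (in the interval/coprime form of
`CoprimeMoebiusIntervals.exists_interval_log_bound`) makes the double sum small except on the diagonal
`y = y'`.  This file proves the resulting bound (`DispersionMainTerm.abs_mainTerm_le`):

  `|Σ_{u,u'} α_u α_{u'} N(u,u')/lcm(u,u')| ≤ 4Y(1 + log U₂) + 2τ(Q) Y²(1 + log Y)·(18 C² B² e^{−2c₀√log⌊√U₁⌋} + 16 U₁^{−1/2})`,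

`Y = y₂ − y₁`, uniformly in `t`, in the level of coprimality `G`, and in the residue `c`; `B` is any bound for the
factors `exp(4Σ_{p∣K}p^{−3/4})` of the coprime Möbius decay at the moduli `K = t·r·G·|m|` that occur.
Method: `N/lcm = Σ_{(y,y')} [(m,u)=1][(m',u')=1]·h_k(gcd(u,u'))/(uu')` with `h_k(n) = n·1[n ∣ k]`, `k = m − m'`;
Möbius inversion `h_k(gcd(u,u')) = Σ_{d∣u, d∣u'} (μ⋆h_k)(d)` decouples `u` from `u'`, `|(μ⋆h_k)(d)| ≤ σ(gcd(d,k))`,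
and each factor `Σ_{d∣u} α_u[(m,u)=1]/u` is `(1/d)·(μ(td)/L)·Σ_{(w, tdG|m|)=1} μ(w)(log td + log w)/w` over a
dyadic block — small by the decay bound for `d ≤ √U₁`, trivially `≤ 2/d` always; the diagonal `y = y'` is bounded
through `gcd(u,u') = Σ_{e∣u,e∣u'} φ(e)`.  The elementary divisor-sum inputs are in
`DispersionMoebiusMainTermPrelims.lean` (same namespace).

## References
* E. Bombieri, J. B. Friedlander, H. Iwaniec, Acta Math. 156 (1986), §§3–4 (dispersion main terms). [folklore]
* H. L. Montgomery, R. C. Vaughan, *Multiplicative Number Theory I*, CUP 2007, §8.1. [folklore]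
-/

noncomputable section

open Finset Real ArithmeticFunction
open scoped ArithmeticFunction.Moebius ArithmeticFunction.sigma ArithmeticFunction.zeta

namespace Literature.NumberTheory.Sieve

namespace DispersionMainTerm

open Literature.NumberTheory.LFunctions.PlateauMollifier
open Literature.NumberTheory.Sieve.CoprimeMoebiusIntervals

/-! ### §1 The inner sums over multiples of `d`: decay from the prime number theorem -/

/-- **Decay of the inner sum.**  With the constants `c₀, C` and the factor bound `B` of the coprime Möbius
interval bounds: for `t, d, G ≥ 1`, `1 ≤ U₁ ≤ U₂`, `1 + log(tU₂) ≤ L`, `m ≠ 0`,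
`|∑_{U₁<u≤U₂, u sqfree, (u,G)=1, d∣u} μ(tu) log(tu)/L · [(m,u)=1]/u| ≤ 3 C B e^{−c₀√log⌊U₁/d⌋}/d`. [folklore] -/
theorem abs_inner_le_decay {c₀ C : ℝ} (hC : 0 ≤ C)
    (hdec : ∀ (k : ℕ), k ≠ 0 → ∀ (V₁ V₂ : ℕ), V₁ ≤ V₂ →
      |∑ n ∈ Ioc V₁ V₂, coprimeMoebiusInvAF k n| ≤
        C * Real.exp (4 * ∑ p ∈ k.primeFactors, (p : ℝ) ^ (-(3 / 4 : ℝ))) *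
          Real.exp (-c₀ * Real.sqrt (Real.log V₁)) ∧
      |∑ n ∈ Ioc V₁ V₂, coprimeMoebiusInvAF k n * Real.log n| ≤
        2 * (C * Real.exp (4 * ∑ p ∈ k.primeFactors, (p : ℝ) ^ (-(3 / 4 : ℝ))) *
          Real.exp (-c₀ * Real.sqrt (Real.log V₁))) * (1 + Real.log V₂))
    {t d G U₁ U₂ : ℕ} {L B : ℝ} {m : ℤ} (ht : 0 < t) (hd : 0 < d) (hG : 0 < G) (hU₁ : 1 ≤ U₁) (hU : U₁ ≤ U₂)
    (hL : 1 + Real.log ((t : ℝ) * U₂) ≤ L) (hm : m ≠ 0)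
    (hB : Real.exp (4 * ∑ p ∈ (t * d * G * m.natAbs).primeFactors, (p : ℝ) ^ (-(3 / 4 : ℝ))) ≤ B) :
    |∑ u ∈ ((Finset.Ioc U₁ U₂).filter (fun u => Squarefree u ∧ u.Coprime G)).filter (fun u => d ∣ u),
        ((μ (t * u) : ℝ) * Real.log ((t : ℝ) * u) / L) * (if Int.gcd m u = 1 then (1 : ℝ) else 0) / u| ≤
      3 * C * B * Real.exp (-c₀ * Real.sqrt (Real.log ((U₁ / d : ℕ) : ℝ))) / d := by
  set M : ℕ := m.natAbs with hMdef
  have hM : 0 < M := Int.natAbs_pos.mpr hm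
  set K : ℕ := t * d * G * M with hKdef
  have hK : K ≠ 0 := by positivity
  set E : ℝ := Real.exp (-c₀ * Real.sqrt (Real.log ((U₁ / d : ℕ) : ℝ))) with hE
  have hE0 : 0 ≤ E := (Real.exp_pos _).le
  set Bf : ℝ := Real.exp (4 * ∑ p ∈ K.primeFactors, (p : ℝ) ^ (-(3 / 4 : ℝ))) with hBf
  have hBf0 : 0 ≤ Bf := (Real.exp_pos _).le
  have hB0 : 0 ≤ B := hBf0.trans hB
  have hL1 : 1 ≤ L := by
    have : 0 ≤ Real.log ((t : ℝ) * U₂) := Real.log_nonneg (by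
      have : (1 : ℝ) ≤ t := by exact_mod_cast ht
      have : (1 : ℝ) ≤ U₂ := by exact_mod_cast (hU₁.trans hU)
      nlinarith)
    linarith
  have hL0 : 0 < L := by linarith
  -- Step 1: rewrite as a sum over `w` with the coefficient identity applied
  have hswap : ((Finset.Ioc U₁ U₂).filter (fun u => Squarefree u ∧ u.Coprime G)).filter (fun u => d ∣ u) =
      ((Finset.Ioc U₁ U₂).filter (fun u => d ∣ u)).filter (fun u => Squarefree u ∧ u.Coprime G) := by
    ext u; simp only [Finset.mem_filter]; tauto
  rw [hswap, Finset.sum_filter, sum_filter_dvd_Ioc_eq hd]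
  have hpt : ∀ w ∈ Finset.Ioc (U₁ / d) (U₂ / d),
      (if Squarefree (d * w) ∧ (d * w).Coprime G then
        ((μ (t * (d * w)) : ℝ) * Real.log ((t : ℝ) * ((d * w : ℕ) : ℝ)) / L) *
          (if Int.gcd m ((d * w : ℕ) : ℤ) = 1 then (1 : ℝ) else 0) / ((d * w : ℕ) : ℝ) else 0) =
      ((if Squarefree d ∧ d.Coprime G ∧ M.Coprime d then (μ (t * d) : ℝ) else 0) / (L * d)) *
        ((coprimeMoebiusInvAF K w) * Real.log ((t : ℝ) * d) + coprimeMoebiusInvAF K w * Real.log w) := by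
    intro w hw
    have hw0 : 0 < w := lt_of_le_of_lt (Nat.zero_le _) (Finset.mem_Ioc.mp hw).1
    have hid := coeff_identity t d G w M
    simp only [int_gcd_natCast_eq_one_iff, coprimeMoebiusInvAF_apply]
    have hlog : Real.log ((t : ℝ) * ((d * w : ℕ) : ℝ)) = Real.log ((t : ℝ) * d) + Real.log w := by
      push_cast
      rw [← mul_assoc, Real.log_mul (by positivity) (by positivity)]
    rw [hlog]
    by_cases h1 : Squarefree (d * w) ∧ (d * w).Coprime G
    · by_cases h2 : M.Coprime (d * w)
      · rw [if_pos h1, if_pos h2]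
        rw [if_pos ⟨h1.1, h1.2, h2⟩] at hid
        rw [show t * (d * w) = t * d * w by ring, hid]
        split_ifs <;> push_cast <;> field_simp <;> ring
      · rw [if_pos h1, if_neg h2]
        have : ¬ (Squarefree (d * w) ∧ (d * w).Coprime G ∧ M.Coprime (d * w)) := fun h => h2 h.2.2
        rw [if_neg this] at hid
        -- the right side vanishes too: from `hid`, `[P d]μ(td) · [cop]μ(w) = 0`
        have hz : (if Squarefree d ∧ d.Coprime G ∧ M.Coprime d then (μ (t * d) : ℝ) else 0) *
            (if w.Coprime (t * d * G * M) then (μ w : ℝ) else 0) = 0 := hid.symm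
        simp only [mul_zero, zero_div]
        rcases mul_eq_zero.mp hz with h | h
        · rw [h]; ring
        · split_ifs at h with hc
          · rw [if_pos hc, h]; ring
          · rw [if_neg hc]; ring
    · rw [if_neg h1]
      have : ¬ (Squarefree (d * w) ∧ (d * w).Coprime G ∧ M.Coprime (d * w)) := fun h => h1 ⟨h.1, h.2.1⟩
      rw [if_neg this] at hid
      have hz : (if Squarefree d ∧ d.Coprime G ∧ M.Coprime d then (μ (t * d) : ℝ) else 0) *
          (if w.Coprime (t * d * G * M) then (μ w : ℝ) else 0) = 0 := hid.symm
      rcases mul_eq_zero.mp hz with h | h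
      · rw [h]; ring
      · split_ifs at h with hc
        · rw [if_pos hc, h]; ring
        · rw [if_neg hc]; ring
  rw [Finset.sum_congr rfl hpt, ← Finset.mul_sum, Finset.sum_add_distrib, ← Finset.sum_mul]
  -- Step 2: the two Möbius sums
  have hV : U₁ / d ≤ U₂ / d := Nat.div_le_div_right hU
  obtain ⟨h0, h1⟩ := hdec K hK (U₁ / d) (U₂ / d) hV
  have hcoef : |(if Squarefree d ∧ d.Coprime G ∧ M.Coprime d then (μ (t * d) : ℝ) else 0) / (L * d)| ≤
      1 / (L * d) := by
    rw [abs_div, abs_of_pos (by positivity : (0 : ℝ) < L * d)]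
    refine div_le_div_of_nonneg_right ?_ (by positivity)
    split_ifs
    · exact_mod_cast ArithmeticFunction.abs_moebius_le_one
    · simp
  -- sizes of the logarithms
  rcases Nat.lt_or_ge U₂ d with hdU | hdU
  · -- empty range
    have : Finset.Ioc (U₁ / d) (U₂ / d) = ∅ := by
      rw [Nat.div_eq_of_lt hdU, Nat.div_eq_of_lt (lt_of_le_of_lt hU hdU)]; rfl
    rw [this]
    simp only [Finset.sum_empty, zero_mul, add_zero, mul_zero, abs_zero]
    positivity
  have htd : Real.log ((t : ℝ) * d) ≤ L - 1 := by
    have : Real.log ((t : ℝ) * d) ≤ Real.log ((t : ℝ) * U₂) :=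
      Real.log_le_log (by positivity) (by
        have : (d : ℝ) ≤ U₂ := by exact_mod_cast hdU
        have : (0 : ℝ) < t := by exact_mod_cast ht
        nlinarith)
    linarith
  have htd0 : 0 ≤ Real.log ((t : ℝ) * d) := Real.log_nonneg (by
    have : (1 : ℝ) ≤ t := by exact_mod_cast ht
    have : (1 : ℝ) ≤ d := by exact_mod_cast hd
    nlinarith)
  have hV₂ : 1 + Real.log ((U₂ / d : ℕ) : ℝ) ≤ L := by
    have h2 : Real.log ((U₂ / d : ℕ) : ℝ) ≤ Real.log ((t : ℝ) * U₂) := by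
      rcases Nat.eq_zero_or_pos (U₂ / d) with hz | hp
      · rw [hz]; simp only [Nat.cast_zero, Real.log_zero]
        exact Real.log_nonneg (by
          have : (1 : ℝ) ≤ t := by exact_mod_cast ht
          have : (1 : ℝ) ≤ U₂ := by exact_mod_cast (hU₁.trans hU)
          nlinarith)
      · apply Real.log_le_log (by exact_mod_cast hp)
        have h3 : ((U₂ / d : ℕ) : ℝ) ≤ U₂ := by exact_mod_cast Nat.div_le_self _ _
        have : (1 : ℝ) ≤ t := by exact_mod_cast ht
        have : (0 : ℝ) ≤ U₂ := by positivity
        nlinarith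
    linarith
  have hlogV₂ : 0 ≤ 1 + Real.log ((U₂ / d : ℕ) : ℝ) := by
    have : 0 ≤ Real.log ((U₂ / d : ℕ) : ℝ) := by
      rcases Nat.eq_zero_or_pos (U₂ / d) with hz | hp
      · rw [hz]; simp
      · exact Real.log_nonneg (by exact_mod_cast hp)
    linarith
  -- assemble
  have hBfB : C * Bf * E ≤ C * B * E := by gcongr
  calc |(if Squarefree d ∧ d.Coprime G ∧ M.Coprime d then (μ (t * d) : ℝ) else 0) / (L * d) *
        ((∑ w ∈ Finset.Ioc (U₁ / d) (U₂ / d), coprimeMoebiusInvAF K w) * Real.log ((t : ℝ) * d) +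
          ∑ w ∈ Finset.Ioc (U₁ / d) (U₂ / d), coprimeMoebiusInvAF K w * Real.log w)|
      = |(if Squarefree d ∧ d.Coprime G ∧ M.Coprime d then (μ (t * d) : ℝ) else 0) / (L * d)| *
          |(∑ w ∈ Finset.Ioc (U₁ / d) (U₂ / d), coprimeMoebiusInvAF K w) * Real.log ((t : ℝ) * d) +
            ∑ w ∈ Finset.Ioc (U₁ / d) (U₂ / d), coprimeMoebiusInvAF K w * Real.log w| := abs_mul _ _
    _ ≤ (1 / (L * d)) * (C * B * E * (L - 1) + 2 * (C * B * E) * L) := by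
        refine mul_le_mul hcoef ?_ (abs_nonneg _) (by positivity)
        refine (abs_add_le _ _).trans (add_le_add ?_ ?_)
        · rw [abs_mul, abs_of_nonneg htd0]
          exact mul_le_mul (h0.trans hBfB) htd (htd0) (by positivity)
        · refine h1.trans ?_
          calc 2 * (C * Bf * E) * (1 + Real.log ((U₂ / d : ℕ) : ℝ)) ≤ 2 * (C * B * E) * (1 + Real.log ((U₂ / d : ℕ) : ℝ)) := by
                gcongr
            _ ≤ 2 * (C * B * E) * L := by gcongr
    _ ≤ 3 * C * B * E / d := by
        rw [div_mul_eq_mul_div, one_mul, div_le_div_iff₀ (by positivity) (by positivity)]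
        have : 0 ≤ C * B * E := by positivity
        have hd0 : (0 : ℝ) < d := by exact_mod_cast hd
        nlinarith

/-! ### §2 The diagonal `y = y'` -/

/-- **The diagonal bound**: for `|b(u,u')| ≤ 1` and `s ⊆ (U₁, U₂]`, `U₂ ≤ 2U₁`:
`|Σ_{u,u'∈s} b(u,u')/lcm(u,u')| ≤ 4(1 + log U₂)`. [folklore] -/
theorem abs_diag_le {U₁ U₂ : ℕ} (hU : U₂ ≤ 2 * U₁) (s : Finset ℕ) (hs : s ⊆ Finset.Ioc U₁ U₂)
    (b : ℕ → ℕ → ℝ) (hb : ∀ u ∈ s, ∀ u' ∈ s, |b u u'| ≤ 1) :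
    |∑ u ∈ s, ∑ u' ∈ s, b u u' / ((Nat.lcm u u' : ℕ) : ℝ)| ≤ 4 * (1 + Real.log U₂) := by
  have hmem : ∀ u ∈ s, 0 < u ∧ u ≤ U₂ := fun u hu => by
    have := Finset.mem_Ioc.mp (hs hu); exact ⟨by omega, this.2⟩
  -- |b/lcm| ≤ gcd/(u u')
  have h1 : |∑ u ∈ s, ∑ u' ∈ s, b u u' / ((Nat.lcm u u' : ℕ) : ℝ)| ≤
      ∑ u ∈ s, ∑ u' ∈ s, (1 : ℝ) / u * ((1 : ℝ) / u') * ∑ e ∈ u.divisors ∩ u'.divisors, (Nat.totient e : ℝ) := by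
    refine (Finset.abs_sum_le_sum_abs _ _).trans (Finset.sum_le_sum fun u hu => ?_)
    refine (Finset.abs_sum_le_sum_abs _ _).trans (Finset.sum_le_sum fun u' hu' => ?_)
    have hu0 := (hmem u hu).1
    have hu0' := (hmem u' hu').1
    rw [← gcd_eq_sum_totient hu0 hu0', abs_div, Nat.abs_cast]
    have hl : 0 < Nat.lcm u u' := Nat.lcm_pos hu0 hu0'
    have hprod : ((Nat.gcd u u' : ℕ) : ℝ) * ((Nat.lcm u u' : ℕ) : ℝ) = (u : ℝ) * u' := by
      exact_mod_cast Nat.gcd_mul_lcm u u'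
    rw [div_le_iff₀ (by exact_mod_cast hl)]
    calc |b u u'| ≤ 1 := hb u hu u' hu'
      _ = 1 / (u : ℝ) * (1 / (u' : ℝ)) * (((Nat.gcd u u' : ℕ) : ℝ) * ((Nat.lcm u u' : ℕ) : ℝ)) := by
          rw [hprod]
          have : (0 : ℝ) < u := by exact_mod_cast hu0
          have : (0 : ℝ) < u' := by exact_mod_cast hu0'
          field_simp
      _ = 1 / (u : ℝ) * (1 / (u' : ℝ)) * ((Nat.gcd u u' : ℕ) : ℝ) * ((Nat.lcm u u' : ℕ) : ℝ) := by ring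
  refine h1.trans ?_
  rw [sum_sum_inter_divisors_eq s hs]
  -- each `e`: `φ(e) (Σ 1/u)² ≤ e · (2/e)² = 4/e`
  have h2 : ∀ e ∈ Finset.Icc 1 U₂, (Nat.totient e : ℝ) * ((∑ u ∈ s.filter (fun u => e ∣ u), (1 : ℝ) / u) *
      (∑ u' ∈ s.filter (fun u => e ∣ u), (1 : ℝ) / u')) ≤ 4 / e := by
    intro e he
    have he0 : 0 < e := (Finset.mem_Icc.mp he).1
    have hS : |∑ u ∈ s.filter (fun u => e ∣ u), (1 : ℝ) / u| ≤ 2 / e := by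
      have := abs_sum_dvd_div_le hU he0 (a := fun _ => (1 : ℝ)) s hs (fun _ _ => by simp)
      simpa using this
    have hS0 : 0 ≤ ∑ u ∈ s.filter (fun u => e ∣ u), (1 : ℝ) / u :=
      Finset.sum_nonneg fun u _ => by positivity
    rw [abs_of_nonneg hS0] at hS
    have hφ : (Nat.totient e : ℝ) ≤ e := by exact_mod_cast Nat.totient_le e
    have he0' : (0 : ℝ) < e := by exact_mod_cast he0
    calc (Nat.totient e : ℝ) * ((∑ u ∈ s.filter (fun u => e ∣ u), (1 : ℝ) / u) *
          (∑ u' ∈ s.filter (fun u => e ∣ u), (1 : ℝ) / u'))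
        ≤ (e : ℝ) * ((2 / e) * (2 / e)) := by
          refine mul_le_mul hφ ?_ (by positivity) (by positivity)
          exact mul_le_mul hS hS hS0 (by positivity)
      _ = 4 / e := by field_simp; ring
  calc ∑ e ∈ Finset.Icc 1 U₂, (Nat.totient e : ℝ) * ((∑ u ∈ s.filter (fun u => e ∣ u), (1 : ℝ) / u) *
        (∑ u' ∈ s.filter (fun u => e ∣ u), (1 : ℝ) / u'))
      ≤ ∑ e ∈ Finset.Icc 1 U₂, (4 : ℝ) / e := Finset.sum_le_sum h2
    _ = 4 * ∑ e ∈ Finset.Icc 1 U₂, (1 : ℝ) / e := by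
        rw [Finset.mul_sum]; refine Finset.sum_congr rfl fun e _ => ?_; ring
    _ ≤ 4 * (1 + Real.log U₂) := by
        refine mul_le_mul_of_nonneg_left ?_ (by norm_num)
        have h := harmonic_le_one_add_log U₂
        have : ∑ d ∈ Finset.Icc 1 U₂, (1 : ℝ) / d = (harmonic U₂ : ℝ) := by
          rw [harmonic_eq_sum_Icc]; push_cast
          refine Finset.sum_congr rfl fun d _ => ?_; simp
        rw [this]; exact h

/-! ### §3 Off the diagonal: `y ≠ y'` -/

/-- The coefficients `a_u = μ(tu) log(tu)/L` are at most `1` in absolute value on `u ≤ U₂`. [folklore] -/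
theorem abs_coeff_le_one {t U₂ u : ℕ} {L : ℝ} (ht : 0 < t) (hu : 0 < u) (huU : u ≤ U₂)
    (hL : 1 + Real.log ((t : ℝ) * U₂) ≤ L) :
    |(μ (t * u) : ℝ) * Real.log ((t : ℝ) * u) / L| ≤ 1 := by
  have hlog0 : 0 ≤ Real.log ((t : ℝ) * u) := Real.log_nonneg (by
    have : (1 : ℝ) ≤ t := by exact_mod_cast ht
    have : (1 : ℝ) ≤ u := by exact_mod_cast hu
    nlinarith)
  have hlogL : Real.log ((t : ℝ) * u) ≤ L := by
    have : Real.log ((t : ℝ) * u) ≤ Real.log ((t : ℝ) * U₂) :=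
      Real.log_le_log (by positivity) (by
        have : (u : ℝ) ≤ U₂ := by exact_mod_cast huU
        have : (0 : ℝ) < t := by exact_mod_cast ht
        nlinarith)
    linarith
  have hL0 : 0 < L := by
    have : 0 ≤ Real.log ((t : ℝ) * U₂) := Real.log_nonneg (by
      have : (1 : ℝ) ≤ t := by exact_mod_cast ht
      have : (1 : ℝ) ≤ U₂ := by exact_mod_cast (hu.trans_le huU : 0 < U₂)
      nlinarith)
    linarith
  rw [abs_div, abs_mul, abs_of_pos hL0, abs_of_nonneg hlog0, div_le_one hL0]
  have hμ : |(μ (t * u) : ℝ)| ≤ 1 := by exact_mod_cast ArithmeticFunction.abs_moebius_le_one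
  calc |(μ (t * u) : ℝ)| * Real.log ((t : ℝ) * u) ≤ 1 * Real.log ((t : ℝ) * u) :=
        mul_le_mul_of_nonneg_right hμ hlog0
    _ ≤ L := by linarith

/-- **The off-diagonal bound.**  With the constants and the factor bound `B` as in `abs_inner_le_decay`,
for `m ≠ m'` (both `≠ 0`):
`|Σ_{u,u'∈U} a_u a_{u'} [(m,u)=1][(m',u')=1][m ≡ m' (mod (u,u'))]/lcm(u,u')| ≤ τ(|m−m'|)(18C²B²e^{−2c₀√log⌊√U₁⌋} + 16/√U₁)`. [folklore] -/
theorem abs_offdiag_le {c₀ C : ℝ} (hc₀ : 0 < c₀) (hC : 0 ≤ C)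
    (hdec : ∀ (k : ℕ), k ≠ 0 → ∀ (V₁ V₂ : ℕ), V₁ ≤ V₂ →
      |∑ n ∈ Ioc V₁ V₂, coprimeMoebiusInvAF k n| ≤
        C * Real.exp (4 * ∑ p ∈ k.primeFactors, (p : ℝ) ^ (-(3 / 4 : ℝ))) *
          Real.exp (-c₀ * Real.sqrt (Real.log V₁)) ∧
      |∑ n ∈ Ioc V₁ V₂, coprimeMoebiusInvAF k n * Real.log n| ≤
        2 * (C * Real.exp (4 * ∑ p ∈ k.primeFactors, (p : ℝ) ^ (-(3 / 4 : ℝ))) *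
          Real.exp (-c₀ * Real.sqrt (Real.log V₁))) * (1 + Real.log V₂))
    {t G U₁ U₂ : ℕ} {L B : ℝ} {m m' : ℤ} (ht : 0 < t) (hG : 0 < G) (hU₁ : 1 ≤ U₁) (hU : U₁ ≤ U₂)
    (hU2 : U₂ ≤ 2 * U₁) (hL : 1 + Real.log ((t : ℝ) * U₂) ≤ L) (hm : m ≠ 0) (hm' : m' ≠ 0) (hmm : m ≠ m')
    (hB1 : 1 ≤ B)
    (hBm : ∀ r : ℕ, 1 ≤ r → r ≤ U₂ →
      Real.exp (4 * ∑ p ∈ (t * r * G * m.natAbs).primeFactors, (p : ℝ) ^ (-(3 / 4 : ℝ))) ≤ B)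
    (hBm' : ∀ r : ℕ, 1 ≤ r → r ≤ U₂ →
      Real.exp (4 * ∑ p ∈ (t * r * G * m'.natAbs).primeFactors, (p : ℝ) ^ (-(3 / 4 : ℝ))) ≤ B) :
    |∑ u ∈ (Finset.Ioc U₁ U₂).filter (fun u => Squarefree u ∧ u.Coprime G),
      ∑ u' ∈ (Finset.Ioc U₁ U₂).filter (fun u => Squarefree u ∧ u.Coprime G),
        ((μ (t * u) : ℝ) * Real.log ((t : ℝ) * u) / L) * ((μ (t * u') : ℝ) * Real.log ((t : ℝ) * u') / L) *
          (if Int.gcd m u = 1 ∧ Int.gcd m' u' = 1 ∧ m ≡ m' [ZMOD (Nat.gcd u u' : ℕ)] then (1 : ℝ) else 0) /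
          ((Nat.lcm u u' : ℕ) : ℝ)| ≤
      ((m - m').natAbs.divisors.card : ℝ) *
        (18 * C ^ 2 * B ^ 2 * Real.exp (-(2 * c₀) * Real.sqrt (Real.log (Nat.sqrt U₁ : ℝ))) +
          16 / Real.sqrt U₁) := by
  set U : Finset ℕ := (Finset.Ioc U₁ U₂).filter (fun u => Squarefree u ∧ u.Coprime G) with hUdef
  have hUs : U ⊆ Finset.Ioc U₁ U₂ := Finset.filter_subset _ _
  have hmemU : ∀ u ∈ U, 0 < u ∧ u ≤ U₂ := fun u hu => by
    have := Finset.mem_Ioc.mp (hUs hu); exact ⟨by omega, this.2⟩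
  set a : ℕ → ℝ := fun u => (μ (t * u) : ℝ) * Real.log ((t : ℝ) * u) / L with hadef
  set k : ℤ := m - m' with hkdef
  have hk : k ≠ 0 := sub_ne_zero.mpr hmm
  have hkpos : 0 < k.natAbs := Int.natAbs_pos.mpr hk
  obtain ⟨H, hH, hinv⟩ := exists_moebius_inversion_gcd k hk
  set A : ℕ → ℝ := fun u => a u * (if Int.gcd m u = 1 then (1 : ℝ) else 0) / u with hAdef
  set A' : ℕ → ℝ := fun u => a u * (if Int.gcd m' u = 1 then (1 : ℝ) else 0) / u with hA'def
  -- Step (i): rewrite the summand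
  have hsummand : ∀ u ∈ U, ∀ u' ∈ U,
      a u * a u' * (if Int.gcd m u = 1 ∧ Int.gcd m' u' = 1 ∧ m ≡ m' [ZMOD (Nat.gcd u u' : ℕ)] then (1 : ℝ) else 0) /
        ((Nat.lcm u u' : ℕ) : ℝ) = A u * A' u' * ∑ d ∈ u.divisors ∩ u'.divisors, H d := by
    intro u hu u' hu'
    have hu0 := (hmemU u hu).1
    have hu0' := (hmemU u' hu').1
    rw [← hinv u u' hu0 hu0']
    have hC : m ≡ m' [ZMOD (Nat.gcd u u' : ℕ)] ↔ ((Nat.gcd u u' : ℕ) : ℤ) ∣ k := by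
      rw [hkdef, Int.modEq_iff_dvd, dvd_sub_comm]
    have hl : 0 < Nat.lcm u u' := Nat.lcm_pos hu0 hu0'
    have hprod : ((Nat.gcd u u' : ℕ) : ℝ) * ((Nat.lcm u u' : ℕ) : ℝ) = (u : ℝ) * u' := by
      exact_mod_cast Nat.gcd_mul_lcm u u'
    have hu0r : (0 : ℝ) < u := by exact_mod_cast hu0
    have hu0r' : (0 : ℝ) < u' := by exact_mod_cast hu0'
    have hlr : (0 : ℝ) < (Nat.lcm u u' : ℕ) := by exact_mod_cast hl
    simp only [hAdef, hA'def]
    by_cases h1 : Int.gcd m u = 1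
    · by_cases h2 : Int.gcd m' u' = 1
      · by_cases h3 : ((Nat.gcd u u' : ℕ) : ℤ) ∣ k
        · rw [if_pos ⟨h1, h2, hC.mpr h3⟩, if_pos h1, if_pos h2, if_pos h3]
          field_simp
          linear_combination (a u * a u') * hprod.symm
        · rw [if_neg (fun h => h3 (hC.mp h.2.2)), if_pos h1, if_pos h2, if_neg h3]; simp
      · rw [if_neg (fun h => h2 h.2.1), if_pos h1, if_neg h2]; simp
    · rw [if_neg (fun h => h1 h.1), if_neg h1]; simp
  have hrew : ∑ u ∈ U, ∑ u' ∈ U,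
      a u * a u' * (if Int.gcd m u = 1 ∧ Int.gcd m' u' = 1 ∧ m ≡ m' [ZMOD (Nat.gcd u u' : ℕ)] then (1 : ℝ) else 0) /
        ((Nat.lcm u u' : ℕ) : ℝ) = ∑ d ∈ Finset.Icc 1 U₂, H d * ((∑ u ∈ U.filter (fun u => d ∣ u), A u) *
          (∑ u' ∈ U.filter (fun u => d ∣ u), A' u')) := by
    rw [← sum_sum_inter_divisors_eq U hUs H A A']
    exact Finset.sum_congr rfl fun u hu => Finset.sum_congr rfl fun u' hu' => hsummand u hu u' hu'
  rw [hrew]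
  -- Step (ii): the bounds for the inner sums
  set D₀ : ℕ := Nat.sqrt U₁ with hD₀
  have hD₀1 : 1 ≤ D₀ := Nat.le_sqrt.mpr (by simpa using hU₁)
  have hD₀U : D₀ ≤ U₂ := (Nat.sqrt_le_self U₁).trans hU
  set δ : ℝ := Real.exp (-c₀ * Real.sqrt (Real.log (D₀ : ℝ))) with hδ
  have hδ0 : 0 ≤ δ := (Real.exp_pos _).le
  have hB0 : 0 ≤ B := by linarith
  -- trivial bounds (all `d ≥ 1`)
  have hcoef1 : ∀ u ∈ U, |a u * (if Int.gcd m u = 1 then (1 : ℝ) else 0)| ≤ 1 := by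
    intro u hu
    rw [abs_mul]
    have h1 := abs_coeff_le_one ht (hmemU u hu).1 (hmemU u hu).2 hL
    have h2 : |(if Int.gcd m u = 1 then (1 : ℝ) else 0)| ≤ 1 := by split_ifs <;> simp
    calc |a u| * |(if Int.gcd m u = 1 then (1 : ℝ) else 0)| ≤ 1 * 1 :=
          mul_le_mul h1 h2 (abs_nonneg _) zero_le_one
      _ = 1 := one_mul _
  have hcoef1' : ∀ u ∈ U, |a u * (if Int.gcd m' u = 1 then (1 : ℝ) else 0)| ≤ 1 := by
    intro u hu
    rw [abs_mul]
    have h1 := abs_coeff_le_one ht (hmemU u hu).1 (hmemU u hu).2 hL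
    have h2 : |(if Int.gcd m' u = 1 then (1 : ℝ) else 0)| ≤ 1 := by split_ifs <;> simp
    calc |a u| * |(if Int.gcd m' u = 1 then (1 : ℝ) else 0)| ≤ 1 * 1 :=
          mul_le_mul h1 h2 (abs_nonneg _) zero_le_one
      _ = 1 := one_mul _
  have htriv : ∀ d, 0 < d → |∑ u ∈ U.filter (fun u => d ∣ u), A u| ≤ 2 / d := fun d hd =>
    abs_sum_dvd_div_le hU2 hd U hUs hcoef1
  have htriv' : ∀ d, 0 < d → |∑ u ∈ U.filter (fun u => d ∣ u), A' u| ≤ 2 / d := fun d hd =>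
    abs_sum_dvd_div_le hU2 hd U hUs hcoef1'
  -- decay bounds for `d ≤ D₀`
  have hdecay : ∀ d, 1 ≤ d → d ≤ D₀ → |∑ u ∈ U.filter (fun u => d ∣ u), A u| ≤ 3 * C * B * δ / d := by
    intro d hd1 hdD
    have hdU : d ≤ U₂ := hdD.trans hD₀U
    have h := abs_inner_le_decay hC hdec ht (by omega) hG hU₁ hU hL hm (hBm d hd1 hdU)
    refine h.trans ?_
    have hmono : Real.exp (-c₀ * Real.sqrt (Real.log ((U₁ / d : ℕ) : ℝ))) ≤ δ := by
      rw [hδ]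
      apply Real.exp_le_exp.mpr
      have hle : (D₀ : ℝ) ≤ ((U₁ / d : ℕ) : ℝ) := by
        have : D₀ ≤ U₁ / d := by
          apply (Nat.le_div_iff_mul_le (by omega)).mpr
          calc D₀ * d ≤ D₀ * D₀ := Nat.mul_le_mul_left _ hdD
            _ ≤ U₁ := Nat.sqrt_le U₁
        exact_mod_cast this
      have hD0r : (1 : ℝ) ≤ D₀ := by exact_mod_cast hD₀1
      have : Real.sqrt (Real.log (D₀ : ℝ)) ≤ Real.sqrt (Real.log ((U₁ / d : ℕ) : ℝ)) :=
        Real.sqrt_le_sqrt (Real.log_le_log (by linarith) hle)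
      nlinarith
    rw [div_le_div_iff_of_pos_right (by exact_mod_cast (show 0 < d by omega))]
    exact mul_le_mul_of_nonneg_left hmono (by positivity)
  have hdecay' : ∀ d, 1 ≤ d → d ≤ D₀ → |∑ u ∈ U.filter (fun u => d ∣ u), A' u| ≤ 3 * C * B * δ / d := by
    intro d hd1 hdD
    have hdU : d ≤ U₂ := hdD.trans hD₀U
    have h := abs_inner_le_decay hC hdec ht (by omega) hG hU₁ hU hL hm' (hBm' d hd1 hdU)
    refine h.trans ?_
    have hmono : Real.exp (-c₀ * Real.sqrt (Real.log ((U₁ / d : ℕ) : ℝ))) ≤ δ := by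
      rw [hδ]
      apply Real.exp_le_exp.mpr
      have hle : (D₀ : ℝ) ≤ ((U₁ / d : ℕ) : ℝ) := by
        have : D₀ ≤ U₁ / d := by
          apply (Nat.le_div_iff_mul_le (by omega)).mpr
          calc D₀ * d ≤ D₀ * D₀ := Nat.mul_le_mul_left _ hdD
            _ ≤ U₁ := Nat.sqrt_le U₁
        exact_mod_cast this
      have hD0r : (1 : ℝ) ≤ D₀ := by exact_mod_cast hD₀1
      have : Real.sqrt (Real.log (D₀ : ℝ)) ≤ Real.sqrt (Real.log ((U₁ / d : ℕ) : ℝ)) :=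
        Real.sqrt_le_sqrt (Real.log_le_log (by linarith) hle)
      nlinarith
    rw [div_le_div_iff_of_pos_right (by exact_mod_cast (show 0 < d by omega))]
    exact mul_le_mul_of_nonneg_left hmono (by positivity)
  -- Step (iii): split the `d`-sum at `D₀`
  rw [show Finset.Icc 1 U₂ = Finset.Ioc 0 U₂ from rfl, ← Finset.sum_Ioc_consecutive _ (Nat.zero_le D₀) hD₀U]
  refine (abs_add_le _ _).trans ?_
  have part1 : |∑ d ∈ Finset.Ioc 0 D₀, H d * ((∑ u ∈ U.filter (fun u => d ∣ u), A u) *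
      (∑ u' ∈ U.filter (fun u => d ∣ u), A' u'))| ≤
      9 * C ^ 2 * B ^ 2 * δ ^ 2 * (2 * (k.natAbs.divisors.card : ℝ)) := by
    refine (Finset.abs_sum_le_sum_abs _ _).trans ?_
    have hpt : ∀ d ∈ Finset.Ioc 0 D₀, |H d * ((∑ u ∈ U.filter (fun u => d ∣ u), A u) *
        (∑ u' ∈ U.filter (fun u => d ∣ u), A' u'))| ≤
        9 * C ^ 2 * B ^ 2 * δ ^ 2 * (((σ 1 (Nat.gcd d k.natAbs) : ℕ) : ℝ) / (d : ℝ) ^ 2) := by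
      intro d hd
      have hd' := Finset.mem_Ioc.mp hd
      have hd1 : 1 ≤ d := hd'.1
      have hd0r : (0 : ℝ) < d := by exact_mod_cast hd'.1
      rw [abs_mul, abs_mul]
      have h1 := hH d hd'.1
      have h2 := hdecay d hd1 hd'.2
      have h3 := hdecay' d hd1 hd'.2
      have hX : (0 : ℝ) ≤ 3 * C * B * δ / d := by positivity
      calc |H d| * (|∑ u ∈ U.filter (fun u => d ∣ u), A u| * |∑ u' ∈ U.filter (fun u => d ∣ u), A' u'|)
          ≤ ((σ 1 (Nat.gcd d k.natAbs) : ℕ) : ℝ) * ((3 * C * B * δ / d) * (3 * C * B * δ / d)) :=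
            mul_le_mul h1 (mul_le_mul h2 h3 (abs_nonneg _) hX)
              (mul_nonneg (abs_nonneg _) (abs_nonneg _)) (Nat.cast_nonneg _)
        _ = 9 * C ^ 2 * B ^ 2 * δ ^ 2 * (((σ 1 (Nat.gcd d k.natAbs) : ℕ) : ℝ) / (d : ℝ) ^ 2) := by
            rw [div_mul_div_comm, mul_div_assoc']
            ring
    refine (Finset.sum_le_sum hpt).trans ?_
    rw [← Finset.mul_sum]
    refine mul_le_mul_of_nonneg_left ?_ (by positivity)
    rw [show Finset.Ioc 0 D₀ = Finset.Icc 1 D₀ from rfl]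
    exact sum_sigma_gcd_div_sq_le hkpos D₀
  have part2 : |∑ d ∈ Finset.Ioc D₀ U₂, H d * ((∑ u ∈ U.filter (fun u => d ∣ u), A u) *
      (∑ u' ∈ U.filter (fun u => d ∣ u), A' u'))| ≤ 4 * (2 * (k.natAbs.divisors.card : ℝ) / D₀) := by
    refine (Finset.abs_sum_le_sum_abs _ _).trans ?_
    have hpt : ∀ d ∈ Finset.Ioc D₀ U₂, |H d * ((∑ u ∈ U.filter (fun u => d ∣ u), A u) *
        (∑ u' ∈ U.filter (fun u => d ∣ u), A' u'))| ≤
        4 * (((σ 1 (Nat.gcd d k.natAbs) : ℕ) : ℝ) / (d : ℝ) ^ 2) := by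
      intro d hd
      have hd' := Finset.mem_Ioc.mp hd
      have hd0 : 0 < d := by omega
      have hd0r : (0 : ℝ) < d := by exact_mod_cast hd0
      rw [abs_mul, abs_mul]
      have hX : (0 : ℝ) ≤ 2 / d := by positivity
      calc |H d| * (|∑ u ∈ U.filter (fun u => d ∣ u), A u| * |∑ u' ∈ U.filter (fun u => d ∣ u), A' u'|)
          ≤ ((σ 1 (Nat.gcd d k.natAbs) : ℕ) : ℝ) * ((2 / d) * (2 / d)) :=
            mul_le_mul (hH d hd0) (mul_le_mul (htriv d hd0) (htriv' d hd0) (abs_nonneg _) hX)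
              (mul_nonneg (abs_nonneg _) (abs_nonneg _)) (Nat.cast_nonneg _)
        _ = 4 * (((σ 1 (Nat.gcd d k.natAbs) : ℕ) : ℝ) / (d : ℝ) ^ 2) := by
            rw [div_mul_div_comm, mul_div_assoc']
            ring
    refine (Finset.sum_le_sum hpt).trans ?_
    rw [← Finset.mul_sum]
    exact mul_le_mul_of_nonneg_left (sum_sigma_gcd_div_sq_tail_le hkpos hD₀1 U₂) (by norm_num)
  refine (add_le_add part1 part2).trans ?_
  -- final algebra: `δ² = e^{-2c₀√log D₀}`, `1/D₀ ≤ 2/√U₁`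
  have hδ2 : δ ^ 2 = Real.exp (-(2 * c₀) * Real.sqrt (Real.log (D₀ : ℝ))) := by
    rw [hδ, sq, ← Real.exp_add]; ring_nf
  have hinv : (1 : ℝ) / (D₀ : ℝ) ≤ 2 / Real.sqrt U₁ := inv_nat_sqrt_le hU₁
  have hτ0 : (0 : ℝ) ≤ (k.natAbs.divisors.card : ℝ) := by positivity
  have hD0r : (0 : ℝ) < D₀ := by exact_mod_cast hD₀1
  rw [← hδ2]
  have : 4 * (2 * (k.natAbs.divisors.card : ℝ) / D₀) ≤ (k.natAbs.divisors.card : ℝ) * (16 / Real.sqrt U₁) := by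
    calc 4 * (2 * (k.natAbs.divisors.card : ℝ) / D₀) = 8 * (k.natAbs.divisors.card : ℝ) * (1 / D₀) := by ring
      _ ≤ 8 * (k.natAbs.divisors.card : ℝ) * (2 / Real.sqrt U₁) :=
          mul_le_mul_of_nonneg_left hinv (by positivity)
      _ = (k.natAbs.divisors.card : ℝ) * (16 / Real.sqrt U₁) := by ring
  nlinarith [this, hτ0, sq_nonneg δ, sq_nonneg C, sq_nonneg B]

/-! ### §4 The main-term bound -/

/-- **Main-term bound for a dispersion with Möbius coefficients.**  Let `t ≥ 1`, `G ≥ 1`, `1 ≤ U₁ ≤ U₂ ≤ 2U₁`,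
`L ≥ 1 + log(tU₂)`, `Q ≥ 1`, `c ∈ ℤ`, `y₁ ≤ y₂` with `m(y) := c + Qy ≠ 0` on `(y₁, y₂]`, and let `B ≥ 1` bound
`exp(4Σ_{p∣K}p^{-3/4})` for all `K = t·r·G·|m(y)|`, `r ≤ U₂`, `y ∈ (y₁,y₂]`.  With
`U = {u ∈ (U₁,U₂] : u squarefree, (u,G) = 1}`, `α_u = μ(tu) log(tu)/L` and
`N(u,u') = #{(y,y') ∈ (y₁,y₂]² : (m(y),u) = 1, (m(y'),u') = 1, m(y) ≡ m(y') (mod gcd(u,u'))}`: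
`|Σ_{u,u'∈U} α_u α_{u'} N(u,u')/lcm(u,u')| ≤ 4Y(1+log U₂) + 2τ(Q)Y²(1+log Y)(18C²B²e^{−2c₀√log⌊√U₁⌋} + 16/√U₁)`,
`Y = y₂ − y₁`, where `c₀ > 0`, `C ≥ 0` are the absolute constants of
`CoprimeMoebiusIntervals.exists_interval_log_bound`. [folklore] -/
theorem abs_mainTerm_le :
    ∃ c₀ : ℝ, 0 < c₀ ∧ ∃ C : ℝ, 0 ≤ C ∧
    ∀ (t G U₁ U₂ Q : ℕ) (L B : ℝ) (c y₁ y₂ : ℤ),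
      0 < t → 0 < G → 1 ≤ U₁ → U₁ ≤ U₂ → U₂ ≤ 2 * U₁ → 0 < Q → y₁ ≤ y₂ →
      1 + Real.log ((t : ℝ) * U₂) ≤ L → 1 ≤ B →
      (∀ y ∈ Finset.Ioc y₁ y₂, c + Q * y ≠ 0) →
      (∀ y ∈ Finset.Ioc y₁ y₂, ∀ r : ℕ, 1 ≤ r → r ≤ U₂ →
        Real.exp (4 * ∑ p ∈ (t * r * G * (c + Q * y).natAbs).primeFactors, (p : ℝ) ^ (-(3 / 4 : ℝ))) ≤ B) →
      |∑ u ∈ (Finset.Ioc U₁ U₂).filter (fun u => Squarefree u ∧ u.Coprime G),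
        ∑ u' ∈ (Finset.Ioc U₁ U₂).filter (fun u => Squarefree u ∧ u.Coprime G),
          ((μ (t * u) : ℝ) * Real.log ((t : ℝ) * u) / L) * ((μ (t * u') : ℝ) * Real.log ((t : ℝ) * u') / L) *
            ((((Finset.Ioc y₁ y₂) ×ˢ (Finset.Ioc y₁ y₂)).filter (fun p : ℤ × ℤ =>
                Int.gcd (c + Q * p.1) u = 1 ∧ Int.gcd (c + Q * p.2) u' = 1 ∧
                c + Q * p.1 ≡ c + Q * p.2 [ZMOD (Nat.gcd u u' : ℕ)])).card : ℝ) /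
            ((Nat.lcm u u' : ℕ) : ℝ)| ≤
        4 * ((y₂ - y₁ : ℤ) : ℝ) * (1 + Real.log U₂) +
          2 * ((Nat.divisors Q).card : ℝ) * ((y₂ - y₁ : ℤ) : ℝ) ^ 2 * (1 + Real.log ((y₂ - y₁ : ℤ) : ℝ)) *
            (18 * C ^ 2 * B ^ 2 * Real.exp (-(2 * c₀) * Real.sqrt (Real.log (Nat.sqrt U₁ : ℝ))) +
              16 / Real.sqrt U₁) := by
  obtain ⟨c₀, hc₀, C, hC, hdec⟩ := exists_interval_log_bound
  refine ⟨c₀, hc₀, C, hC, ?_⟩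
  intro t G U₁ U₂ Q L B c y₁ y₂ ht hG hU₁ hU hU2 hQ hy hL hB1 hm0 hBfac
  set U : Finset ℕ := (Finset.Ioc U₁ U₂).filter (fun u => Squarefree u ∧ u.Coprime G) with hUdef
  have hUs : U ⊆ Finset.Ioc U₁ U₂ := Finset.filter_subset _ _
  have hmemU : ∀ u ∈ U, 0 < u ∧ u ≤ U₂ := fun u hu => by
    have := Finset.mem_Ioc.mp (hUs hu); exact ⟨by omega, this.2⟩
  set a : ℕ → ℝ := fun u => (μ (t * u) : ℝ) * Real.log ((t : ℝ) * u) / L with hadef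
  set s : Finset ℤ := Finset.Ioc y₁ y₂ with hsdef
  set Y : ℕ := (y₂ - y₁).toNat with hYdef
  have hYZ : ((Y : ℕ) : ℤ) = y₂ - y₁ := Int.toNat_of_nonneg (sub_nonneg.mpr hy)
  have hYR : ((y₂ - y₁ : ℤ) : ℝ) = (Y : ℝ) := by rw [← hYZ]; simp
  have hscard : s.card = Y := by rw [hsdef, Int.card_Ioc]
  set P2 : Finset (ℤ × ℤ) := s ×ˢ s with hP2
  set W : ℝ := 18 * C ^ 2 * B ^ 2 * Real.exp (-(2 * c₀) * Real.sqrt (Real.log (Nat.sqrt U₁ : ℝ))) +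
    16 / Real.sqrt U₁ with hWdef
  have hW0 : 0 ≤ W := by positivity
  -- the pair sum `T p`
  set T : ℤ × ℤ → ℝ := fun p => ∑ u ∈ U, ∑ u' ∈ U, a u * a u' *
    (if Int.gcd (c + Q * p.1) u = 1 ∧ Int.gcd (c + Q * p.2) u' = 1 ∧
        c + Q * p.1 ≡ c + Q * p.2 [ZMOD (Nat.gcd u u' : ℕ)] then (1 : ℝ) else 0) / ((Nat.lcm u u' : ℕ) : ℝ)
    with hTdef
  -- Step 1: the sum equals `Σ_{p ∈ s × s} T p`
  have hcard : ∀ u u' : ℕ, ((P2.filter (fun p : ℤ × ℤ => Int.gcd (c + Q * p.1) u = 1 ∧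
      Int.gcd (c + Q * p.2) u' = 1 ∧ c + Q * p.1 ≡ c + Q * p.2 [ZMOD (Nat.gcd u u' : ℕ)])).card : ℝ) =
      ∑ p ∈ P2, (if Int.gcd (c + Q * p.1) u = 1 ∧ Int.gcd (c + Q * p.2) u' = 1 ∧
        c + Q * p.1 ≡ c + Q * p.2 [ZMOD (Nat.gcd u u' : ℕ)] then (1 : ℝ) else 0) := by
    intro u u'
    rw [Finset.card_filter]; push_cast
    refine Finset.sum_congr rfl fun p _ => ?_
    split_ifs <;> simp
  have hS : (∑ u ∈ U, ∑ u' ∈ U, a u * a u' *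
      ((P2.filter (fun p : ℤ × ℤ => Int.gcd (c + Q * p.1) u = 1 ∧ Int.gcd (c + Q * p.2) u' = 1 ∧
          c + Q * p.1 ≡ c + Q * p.2 [ZMOD (Nat.gcd u u' : ℕ)])).card : ℝ) / ((Nat.lcm u u' : ℕ) : ℝ)) =
      ∑ p ∈ P2, T p := by
    calc (∑ u ∈ U, ∑ u' ∈ U, a u * a u' *
        ((P2.filter (fun p : ℤ × ℤ => Int.gcd (c + Q * p.1) u = 1 ∧ Int.gcd (c + Q * p.2) u' = 1 ∧
            c + Q * p.1 ≡ c + Q * p.2 [ZMOD (Nat.gcd u u' : ℕ)])).card : ℝ) / ((Nat.lcm u u' : ℕ) : ℝ))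
        = ∑ u ∈ U, ∑ u' ∈ U, ∑ p ∈ P2, a u * a u' *
            (if Int.gcd (c + Q * p.1) u = 1 ∧ Int.gcd (c + Q * p.2) u' = 1 ∧
              c + Q * p.1 ≡ c + Q * p.2 [ZMOD (Nat.gcd u u' : ℕ)] then (1 : ℝ) else 0) /
            ((Nat.lcm u u' : ℕ) : ℝ) := by
          refine Finset.sum_congr rfl fun u _ => Finset.sum_congr rfl fun u' _ => ?_
          rw [hcard, Finset.mul_sum, Finset.sum_div]
      _ = ∑ u ∈ U, ∑ p ∈ P2, ∑ u' ∈ U, a u * a u' *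
            (if Int.gcd (c + Q * p.1) u = 1 ∧ Int.gcd (c + Q * p.2) u' = 1 ∧
              c + Q * p.1 ≡ c + Q * p.2 [ZMOD (Nat.gcd u u' : ℕ)] then (1 : ℝ) else 0) /
            ((Nat.lcm u u' : ℕ) : ℝ) := Finset.sum_congr rfl fun u _ => Finset.sum_comm
      _ = ∑ p ∈ P2, T p := Finset.sum_comm
  rw [hS, hP2, ← Finset.diag_union_offDiag, Finset.sum_union (Finset.disjoint_diag_offDiag s)]
  refine (abs_add_le _ _).trans ?_
  -- Step 2: the diagonal
  have hdiag : |∑ p ∈ s.diag, T p| ≤ 4 * ((y₂ - y₁ : ℤ) : ℝ) * (1 + Real.log U₂) := by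
    refine (Finset.abs_sum_le_sum_abs _ _).trans ?_
    have hpt : ∀ p ∈ s.diag, |T p| ≤ 4 * (1 + Real.log U₂) := by
      intro p _
      refine abs_diag_le hU2 U hUs (fun u u' => a u * a u' *
        (if Int.gcd (c + Q * p.1) u = 1 ∧ Int.gcd (c + Q * p.2) u' = 1 ∧
            c + Q * p.1 ≡ c + Q * p.2 [ZMOD (Nat.gcd u u' : ℕ)] then (1 : ℝ) else 0)) ?_
      intro u hu u' hu'
      rw [abs_mul, abs_mul]
      have h1 := abs_coeff_le_one ht (hmemU u hu).1 (hmemU u hu).2 hL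
      have h2 := abs_coeff_le_one ht (hmemU u' hu').1 (hmemU u' hu').2 hL
      have h3 : |(if Int.gcd (c + Q * p.1) u = 1 ∧ Int.gcd (c + Q * p.2) u' = 1 ∧
          c + Q * p.1 ≡ c + Q * p.2 [ZMOD (Nat.gcd u u' : ℕ)] then (1 : ℝ) else 0)| ≤ 1 := by
        split_ifs <;> simp
      calc |a u| * |a u'| * _ ≤ 1 * 1 * 1 := by
            refine mul_le_mul (mul_le_mul h1 h2 (abs_nonneg _) zero_le_one) h3 (abs_nonneg _) (by positivity)
        _ = 1 := by ring
    calc ∑ p ∈ s.diag, |T p| ≤ ∑ p ∈ s.diag, 4 * (1 + Real.log U₂) := Finset.sum_le_sum hpt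
      _ = 4 * ((y₂ - y₁ : ℤ) : ℝ) * (1 + Real.log U₂) := by
          rw [Finset.sum_const, Finset.diag_card, hscard, nsmul_eq_mul, hYR]; ring
  -- Step 3: off the diagonal
  have hoff : |∑ p ∈ s.offDiag, T p| ≤
      2 * ((Nat.divisors Q).card : ℝ) * ((y₂ - y₁ : ℤ) : ℝ) ^ 2 * (1 + Real.log ((y₂ - y₁ : ℤ) : ℝ)) * W := by
    refine (Finset.abs_sum_le_sum_abs _ _).trans ?_
    have hpt : ∀ p ∈ s.offDiag, |T p| ≤
        ((Nat.divisors Q).card : ℝ) * ((((p.1 - p.2).natAbs).divisors.card : ℝ) * W) := by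
      intro p hp
      rw [Finset.mem_offDiag] at hp
      obtain ⟨hp1, hp2, hne⟩ := hp
      have hmne : c + Q * p.1 ≠ c + Q * p.2 := by
        intro h
        have hQ0 : (Q : ℤ) ≠ 0 := by exact_mod_cast hQ.ne'
        have : (Q : ℤ) * (p.1 - p.2) = 0 := by linarith
        rcases mul_eq_zero.mp this with h' | h'
        · exact hQ0 h'
        · exact hne (sub_eq_zero.mp h')
      have h := abs_offdiag_le hc₀ hC hdec ht hG hU₁ hU hU2 hL (hm0 p.1 hp1) (hm0 p.2 hp2) hmne hB1
        (fun r hr1 hr2 => hBfac p.1 hp1 r hr1 hr2) (fun r hr1 hr2 => hBfac p.2 hp2 r hr1 hr2)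
      refine h.trans ?_
      have hdiff : (c + Q * p.1 - (c + Q * p.2)).natAbs = Q * (p.1 - p.2).natAbs := by
        rw [show c + Q * p.1 - (c + Q * p.2) = (Q : ℤ) * (p.1 - p.2) by ring, Int.natAbs_mul,
          Int.natAbs_natCast]
      rw [hdiff]
      have hτ : (((Q * (p.1 - p.2).natAbs).divisors.card : ℕ) : ℝ) ≤
          ((Nat.divisors Q).card : ℝ) * (((p.1 - p.2).natAbs).divisors.card : ℝ) := by
        exact_mod_cast DFI1995.card_divisors_mul_le Q _
      calc (((Q * (p.1 - p.2).natAbs).divisors.card : ℕ) : ℝ) * W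
          ≤ (((Nat.divisors Q).card : ℝ) * (((p.1 - p.2).natAbs).divisors.card : ℝ)) * W :=
            mul_le_mul_of_nonneg_right hτ hW0
        _ = _ := by ring
    calc ∑ p ∈ s.offDiag, |T p|
        ≤ ∑ p ∈ s.offDiag, ((Nat.divisors Q).card : ℝ) * ((((p.1 - p.2).natAbs).divisors.card : ℝ) * W) :=
          Finset.sum_le_sum hpt
      _ = ((Nat.divisors Q).card : ℝ) * W * ∑ p ∈ s.offDiag, (((p.1 - p.2).natAbs).divisors.card : ℝ) := by
          rw [Finset.mul_sum]; refine Finset.sum_congr rfl fun p _ => ?_; ring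
      _ ≤ ((Nat.divisors Q).card : ℝ) * W *
            (2 * ((y₂ - y₁ : ℤ) : ℝ) * (((y₂ - y₁ : ℤ) : ℝ) * (1 + Real.log ((y₂ - y₁ : ℤ) : ℝ)))) :=
          mul_le_mul_of_nonneg_left (sum_offDiag_card_divisors_le hy) (by positivity)
      _ = 2 * ((Nat.divisors Q).card : ℝ) * ((y₂ - y₁ : ℤ) : ℝ) ^ 2 * (1 + Real.log ((y₂ - y₁ : ℤ) : ℝ)) * W := by
          ring
  exact add_le_add hdiag hoff

end DispersionMainTerm

end Literature.NumberTheory.Sieve
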